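import Mathlib
import Literature.Analysis.FluidPDE.ClassicalSolution
import Literature.Analysis.FluidPDE.LerayHopf
import Literature.Analysis.FluidPDE.NSWave0
import Summits.NavierStokesRegularity.NavierStokesRegularity.Theses.L3TimeExponentPincer
import HarnessLib

/-!
# Frame tightness of crux `L3CascadeJaw` (stmt-NavierStokesRegularity-19499):
# the Leray–Hopf hypothesis cannot be dropped

Support file for the PARENT crux `L3CascadeJaw` of route `L3TimeExponentPincer` (cell
ns-regularity-ideate, seat ns-pincer-19499-p1).  The crux quantifies over the tree's frame: classical
solutions `(u, p)` of the unforced Navier–Stokes system on `ℝ³ × [0,T)` (`IsClassicalNSSolutionOn`) that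
are Leray–Hopf on `[0,T)` from their datum (`IsLerayHopfOn T ν 0 (u 0) u`) with `u 0` rapidly decaying
(`HasRapidSpatialDecay`), and asks `∫_{T₂}^T ‖u(t)‖_{L³}^q dt < ∞` on a final window for `4 < q < 5`.

This file certifies which frame hypothesis carries the integrability content at all: the
**Galilean-accelerated uniform flow** `u(t, x) = t • e`, `p(t, x) = -⟪e, x⟫` (`e ≠ 0` a fixed vector) is
an exact classical Navier–Stokes flow on every time set of unique differentiability, for EVERY viscosity
(`∂ₜu = e = -∇p`, `(u·∇)u = 0`, `Δu = 0`, `div u = 0`), its datum `u 0 = 0` is rapidly decaying (indeed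
every datum-side hypothesis holds), and `‖u(t)‖_{L³(ℝ³)} = ∞` for every `t > 0`, so the jaw integral is
`∞` on every final window and for every exponent `q > 0`:

* `isClassicalNSSolutionOn_uniformAccel`, `hasRapidSpatialDecay_uniformAccel_zero`,
  `eLpNorm_three_const_eq_top`, `jawIntegral_uniformAccel_eq_top`;
* `not_memLp_two_uniformAccel` — the witness violates exactly the finite-energy field `memLp` of
  `IsLerayHopfOn` (it is the classical non-uniqueness branch of solutions unbounded at spatial infinity);
* **`l3CascadeJaw_false_without_isLerayHopfOn`** — the crux's statement with the hypothesis
  `IsLerayHopfOn T ν 0 (u 0) u` deleted (everything else verbatim) is FALSE; and the sharper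
  `jawClause_false_without_isLerayHopfOn_all` — it fails at EVERY `q > 0`, `ν > 0`, `T > 0`.

Reading for the line: any proof of `L3CascadeJaw` must use the energy class of the SOLUTION (not only the
equation, smoothness on `[0,T)` and the datum); in cdisprove vocabulary this is the
`L3CascadeJaw_false_without_IsLerayHopfOn` entry of the crux's hypothesis audit.  The other two deletions
are not refutable in ZFC-cheap ways: dropping `HasRapidSpatialDecay (u 0)` leaves the same open problem for
`L²` data, dropping `IsClassicalNSSolutionOn` leaves it for Leray–Hopf weak solutions.

References: the pressure-driven uniform flows `u(x,t) = b(t)`, `p(x,t) = -b'(t)·x` are the "parasitic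
solutions" of Koch–Nadirashvili–Seregin–Šverák, *Liouville theorems for the Navier–Stokes equations and
applications*, Acta Math. 203 (2009), §1 (arXiv:0709.3599 p. 3): "Equation (1.1) has trivial non-constant
solutions of the form `u(x,t) = b(t)`, `p(x,t) = -b'(t)x`" — the textbook non-uniqueness of Navier–Stokes
without conditions at spatial infinity (the tree already cites them in
`Literature.Analysis.FluidPDE.AncientL3BackwardLiouville`).

WHAT THIS IS NOT: not a statement about Navier–Stokes regularity or blow-up, and no progress on the crux's
mathematics; a kernel-checked hypothesis-tightness certificate for the crux AS TYPED, landed `--supports`.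
-/

noncomputable section

namespace Summit.NavierStokesRegularity.NavierStokesRegularity.Theorems.L3TimeExponentPincerJawFrameTightness

open MeasureTheory Set Function Filter Topology InnerProductSpace
open scoped ENNReal NNReal RealInnerProductSpace Laplacian ContDiff
open Literature.Analysis.FluidPDE

/-! ### The Galilean-accelerated uniform flow is an exact classical Navier–Stokes flow -/

/-- The gradient of the linear functional `x ↦ -⟪e, x⟫` is the constant vector `-e`. [folklore] -/
theorem hasGradientAt_neg_inner_left (e x : EuclideanSpace ℝ (Fin 3)) :
    HasGradientAt (fun y : EuclideanSpace ℝ (Fin 3) => -⟪e, y⟫) (-e) x := by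
  rw [hasGradientAt_iff_hasFDerivAt]
  have h : HasFDerivAt (fun y : EuclideanSpace ℝ (Fin 3) => ⟪e, y⟫)
      (InnerProductSpace.toDual ℝ (EuclideanSpace ℝ (Fin 3)) e) x := by
    have := (InnerProductSpace.toDual ℝ (EuclideanSpace ℝ (Fin 3)) e).hasFDerivAt (x := x)
    refine this.congr_of_eventuallyEq (Eventually.of_forall fun y => ?_)
    simp [InnerProductSpace.toDual_apply_apply]
  have h' := h.neg
  rw [map_neg]
  exact h'

/-- `∇(-⟪e, ·⟫)(x) = -e`. [folklore] -/
theorem gradient_neg_inner_left (e x : EuclideanSpace ℝ (Fin 3)) :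
    gradient (fun y : EuclideanSpace ℝ (Fin 3) => -⟪e, y⟫) x = -e :=
  (hasGradientAt_neg_inner_left e x).gradient

/-- **The Galilean-accelerated uniform flow `u(t,x) = t • e`, `p(t,x) = -⟪e, x⟫` is an exact classical
Navier–Stokes flow** on `ℝ³ × S` for every time set `S` of unique differentiability, every viscosity `ν`
and every vector `e`: `∂ₜu = e`, `(u·∇)u = 0`, `Δu = 0`, `∇p = -e`, `div u = 0`.
[cite: KochNadirashviliSereginSverak2009, §1 p. 3 (parasitic solutions b(t))] -/
theorem isClassicalNSSolutionOn_uniformAccel (e : EuclideanSpace ℝ (Fin 3)) {S : Set ℝ}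
    (hS : UniqueDiffOn ℝ S) (ν : ℝ) :
    IsClassicalNSSolutionOn S ν 0 (fun (t : ℝ) (_ : EuclideanSpace ℝ (Fin 3)) => t • e)
      (fun (_ : ℝ) (x : EuclideanSpace ℝ (Fin 3)) => -⟪e, x⟫) where
  smooth_velocity := by
    have h : uncurry (fun (t : ℝ) (_ : EuclideanSpace ℝ (Fin 3)) => t • e) =
        fun z : ℝ × EuclideanSpace ℝ (Fin 3) => z.1 • e := by
      funext z; rfl
    show ContDiffOn ℝ ∞ (uncurry fun (t : ℝ) (_ : EuclideanSpace ℝ (Fin 3)) => t • e) (S ×ˢ univ)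
    rw [h]
    exact (contDiff_fst.smul contDiff_const).contDiffOn
  smooth_pressure := by
    have h : uncurry (fun (_ : ℝ) (x : EuclideanSpace ℝ (Fin 3)) => -⟪e, x⟫) =
        fun z : ℝ × EuclideanSpace ℝ (Fin 3) => -⟪e, z.2⟫ := by
      funext z; rfl
    show ContDiffOn ℝ ∞ (uncurry fun (_ : ℝ) (x : EuclideanSpace ℝ (Fin 3)) => -⟪e, x⟫) (S ×ˢ univ)
    rw [h]
    exact (contDiff_const.inner ℝ contDiff_snd).neg.contDiffOn
  momentum t ht x := by
    have hd : timeDerivWithin S (fun (t : ℝ) (_ : EuclideanSpace ℝ (Fin 3)) => t • e) t x = e := by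
      rw [timeDerivWithin_apply]
      have h1 : HasDerivAt (fun s : ℝ => s • e) e t := by
        simpa using (hasDerivAt_id t).smul_const e
      exact h1.hasDerivWithinAt.derivWithin (hS t ht)
    have hc : convect (fun _ : EuclideanSpace ℝ (Fin 3) => t • e) (fun _ : EuclideanSpace ℝ (Fin 3) => t • e) x = 0 := by
      rw [convect_apply, fderiv_const_apply]; rfl
    have hl : Δ (fun _ : EuclideanSpace ℝ (Fin 3) => t • e) x = 0 := by
      rw [InnerProductSpace.laplacian_const]; rfl
    rw [hd, hc, hl, gradient_neg_inner_left]
    simp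
  divFree t _ x := by
    show VectorCalculus.divergence (fun _ : EuclideanSpace ℝ (Fin 3) => t • e) x = 0
    rw [VectorCalculus.divergence, fderiv_const_apply]
    simp

/-- The datum of the uniform flow is `u 0 = 0`, which decays rapidly (every iterated derivative of the
zero field vanishes). [folklore] -/
theorem hasRapidSpatialDecay_uniformAccel_zero (e : EuclideanSpace ℝ (Fin 3)) :
    HasRapidSpatialDecay ((fun (t : ℝ) (_ : EuclideanSpace ℝ (Fin 3)) => t • e) 0) := by
  intro n K
  refine ⟨0, fun x => ?_⟩
  have h0 : ((fun (t : ℝ) (_ : EuclideanSpace ℝ (Fin 3)) => t • e) 0) =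
      fun _ : EuclideanSpace ℝ (Fin 3) => (0 : EuclideanSpace ℝ (Fin 3)) := by
    funext x; simp
  rw [h0, iteratedFDeriv_fun_zero]
  simp

/-! ### Its `L³` norm is infinite at every positive time -/

/-- Lebesgue measure of `ℝ³` is infinite. [folklore] -/
theorem volume_univ_eq_top :
    (volume : Measure (EuclideanSpace ℝ (Fin 3))) univ = ⊤ :=
  measure_univ_of_isAddLeftInvariant _

/-- A non-zero constant field on `ℝ³` has infinite `L³` norm. [folklore] -/
theorem eLpNorm_three_const_eq_top {c : EuclideanSpace ℝ (Fin 3)} (hc : c ≠ 0) :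
    eLpNorm (fun _ : EuclideanSpace ℝ (Fin 3) => c) 3 volume = ⊤ := by
  by_contra h
  have hlt : eLpNorm (fun _ : EuclideanSpace ℝ (Fin 3) => c) 3 volume < ⊤ := lt_top_iff_ne_top.2 h
  rw [eLpNorm_const_lt_top_iff (by norm_num) (by norm_num)] at hlt
  rcases hlt with h0 | hfin
  · exact hc h0
  · exact (lt_irrefl _) (volume_univ_eq_top ▸ hfin)

/-- For `t ≠ 0` and `e ≠ 0` the slice `u(t) = t • e` of the uniform flow has `‖u(t)‖_{L³} = ∞`. [folklore] -/
theorem eLpNorm_three_uniformAccel_eq_top {e : EuclideanSpace ℝ (Fin 3)} (he : e ≠ 0) {t : ℝ}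
    (ht : t ≠ 0) :
    eLpNorm ((fun (t : ℝ) (_ : EuclideanSpace ℝ (Fin 3)) => t • e) t) 3 volume = ⊤ :=
  eLpNorm_three_const_eq_top (smul_ne_zero ht he)

/-- **The jaw integral of the uniform flow is `∞` on every final window**: for `e ≠ 0`, `q > 0` and
`0 ≤ T₂ < T`, `∫_{T₂}^{T} ‖u(t)‖₃^q dt = ∞` (the integrand is `∞` at every time of the window).
[folklore] -/
theorem jawIntegral_uniformAccel_eq_top {e : EuclideanSpace ℝ (Fin 3)} (he : e ≠ 0) {q : ℝ}
    (hq : 0 < q) {T₂ T : ℝ} (hT₂ : 0 ≤ T₂) (hT₂T : T₂ < T) :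
    (∫⁻ t in Ioo T₂ T,
      eLpNorm ((fun (t : ℝ) (_ : EuclideanSpace ℝ (Fin 3)) => t • e) t) 3 volume ^ q) = ⊤ := by
  have hconst : ∀ t ∈ Ioo T₂ T,
      eLpNorm ((fun (t : ℝ) (_ : EuclideanSpace ℝ (Fin 3)) => t • e) t) 3 volume ^ q = ⊤ := by
    intro t ht
    rw [eLpNorm_three_uniformAccel_eq_top he (by linarith [ht.1] : t ≠ 0), ENNReal.top_rpow_of_pos hq]
  rw [setLIntegral_congr_fun measurableSet_Ioo hconst, setLIntegral_const]
  simp [Real.volume_Ioo, hT₂T]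

/-! ### It is not Leray–Hopf: exactly the finite-energy field fails -/

/-- The uniform flow violates the finite-energy field `memLp` of `IsLerayHopfOn` (at `t = T > 0`):
`u(T) = T • e ∉ L²(ℝ³)` for `e ≠ 0`. [folklore] -/
theorem not_memLp_two_uniformAccel {e : EuclideanSpace ℝ (Fin 3)} (he : e ≠ 0) {T : ℝ} (hT : 0 < T) :
    ¬ MemLp ((fun (t : ℝ) (_ : EuclideanSpace ℝ (Fin 3)) => t • e) T) 2
      (volume : Measure (EuclideanSpace ℝ (Fin 3))) := by
  intro h
  have h' := (memLp_const_iff (p := (2 : ℝ≥0∞)) (c := T • e) (by norm_num) (by norm_num)).1 h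
  rcases h' with h0 | hfin
  · exact smul_ne_zero hT.ne' he h0
  · exact (lt_irrefl _) (volume_univ_eq_top ▸ hfin)

/-- Hence the uniform flow is not Leray–Hopf on `[0,T)`, `T > 0` (field `memLp` at `t = T`). [folklore] -/
theorem not_isLerayHopfOn_uniformAccel {e : EuclideanSpace ℝ (Fin 3)} (he : e ≠ 0) {T : ℝ} (hT : 0 < T)
    (ν : ℝ) :
    ¬ IsLerayHopfOn T ν 0 ((fun (t : ℝ) (_ : EuclideanSpace ℝ (Fin 3)) => t • e) 0)
        (fun (t : ℝ) (_ : EuclideanSpace ℝ (Fin 3)) => t • e) := fun h =>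
  not_memLp_two_uniformAccel he hT (h.memLp T ⟨hT.le, le_rfl⟩)

/-! ### The crux without the Leray–Hopf hypothesis is false -/

/-- **Sharp form**: for EVERY exponent `q > 0`, viscosity `ν` and time `T` there is a classical solution of
the unforced Navier–Stokes system on `ℝ³ × [0,T)` with rapidly decaying (indeed zero) datum whose jaw
integral `∫_{T₂}^T ‖u(t)‖₃^q dt` is infinite on every final window — the Galilean-accelerated uniform
flow with `e = e₀`. [cite: KochNadirashviliSereginSverak2009, §1 p. 3 (parasitic solutions b(t))] -/
theorem jawClause_false_without_isLerayHopfOn_all (q : ℝ) (hq : 0 < q) (ν T : ℝ) :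
    ∃ (u : ℝ → EuclideanSpace ℝ (Fin 3) → EuclideanSpace ℝ (Fin 3)) (p : ℝ → EuclideanSpace ℝ (Fin 3) → ℝ),
      IsClassicalNSSolutionOn (Ico 0 T) ν 0 u p ∧ HasRapidSpatialDecay (u 0) ∧ u 0 = 0 ∧
        ¬ ∃ T₂ ∈ Ioo 0 T, (∫⁻ t in Ioo T₂ T, eLpNorm (u t) 3 volume ^ q) < ⊤ := by
  set e : EuclideanSpace ℝ (Fin 3) := EuclideanSpace.single 0 1 with he_def
  have he : e ≠ 0 := by
    intro h
    have := congrArg (fun v : EuclideanSpace ℝ (Fin 3) => v 0) h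
    simp [he_def] at this
  refine ⟨fun t _ => t • e, fun _ x => -⟪e, x⟫, isClassicalNSSolutionOn_uniformAccel e (uniqueDiffOn_Ico 0 T) ν,
    hasRapidSpatialDecay_uniformAccel_zero e, ?_, ?_⟩
  · funext x; simp
  · rintro ⟨T₂, hT₂, hfin⟩
    rw [jawIntegral_uniformAccel_eq_top he hq hT₂.1.le hT₂.2] at hfin
    exact lt_irrefl _ hfin

/-- **`L3CascadeJaw` is false without its Leray–Hopf hypothesis.**  The statement of crux
stmt-NavierStokesRegularity-19499 with the conjunct `IsLerayHopfOn T ν 0 (u 0) u` deleted — everything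
else verbatim (exponent range `4 < q < 5`, classical solution on `[0,T)`, rapidly decaying datum,
final-window `L^q_t L³_x` integrability) — is refuted by the Galilean-accelerated uniform flow
`u = t • e₀`, `p = -x₀` at `q = 9/2`, `ν = T = 1`.  So the finite-energy class of the SOLUTION is a
load-bearing hypothesis of the crux; hypotheses on the datum alone (here the datum is `0`) cannot replace it.
[cite: KochNadirashviliSereginSverak2009, §1 p. 3 (parasitic solutions b(t))] -/
theorem l3CascadeJaw_false_without_isLerayHopfOn :
    ¬ (∀ q : ℝ, 4 < q → q < 5 → ∀ (ν T : ℝ), 0 < ν → 0 < T →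
        ∀ (u : ℝ → EuclideanSpace ℝ (Fin 3) → EuclideanSpace ℝ (Fin 3)) (p : ℝ → EuclideanSpace ℝ (Fin 3) → ℝ),
          IsClassicalNSSolutionOn (Ico 0 T) ν 0 u p → HasRapidSpatialDecay (u 0) →
          ∃ T₂ ∈ Ioo 0 T, (∫⁻ t in Ioo T₂ T, eLpNorm (u t) 3 volume ^ q) < ⊤) := by
  intro h
  obtain ⟨u, p, hcl, hdec, -, hnot⟩ :=
    jawClause_false_without_isLerayHopfOn_all (9 / 2) (by norm_num) 1 1
  exact hnot (h (9 / 2) (by norm_num) (by norm_num) 1 1 one_pos one_pos u p hcl hdec)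

end Summit.NavierStokesRegularity.NavierStokesRegularity.Theorems.L3TimeExponentPincerJawFrameTightness

end
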